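import Literature.NumberTheory.Sieve.DrappeauDispersionR1ppBlocks
import HarnessLib

/-!
# Drappeau 2017, §5.5: the coefficients `b_{𝐧,𝐫,𝐬}` and the left-hand side of Theorem 2.1

Topic `Literature/NumberTheory/Sieve`, part of the formalisation of §5 of S. Drappeau, Proc. London
Math. Soc. (3) 114 (2017) 684–732 = arXiv:1504.05549.  On p. 20 the sequence `b_{𝐧,𝐫,𝐬}` fed to
Theorem 2.1 is described in words ("for some sequence of coefficients bounded by `τ(n₀𝐬)^A τ(𝐫)^A`",
after the changes of variables `𝐫 ← a₂n₀n₂`, `𝐬 ← n₁`, `𝐧 ← a₁h(n₁ − n₂)/q₀`).  Here it is made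
explicit — with the normalisations of this formalisation (`𝐫 = |a₂|n₀δ₁n₂`, `𝐬 = δ₂n₁`,
`𝐧 = nVar σ …`, a sign `σ` and a dyadic block `[nlo, nhi)`) — as a sum over the at most one triple
`(n₁, n₂, h)` encoding `(𝐧, 𝐫, 𝐬)`, and the left-hand side of Theorem 2.1 with these coefficients is
rewritten as a sum over `(𝐜, 𝐝, n₁, n₂, h)` ("collapsing" the sums over `𝐧, 𝐫, 𝐬`).  Everything
proved; the only definition is `bCoef`.

* `Drappeau2017.bCoef` — the coefficients;
* `ite_sum3_mul`, `sum3_collapse` — bookkeeping;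
* `cruxLHS_bCoef_eq` — the collapsed form of the quintilinear sum with coefficients `bCoef`.

## References

* S. Drappeau, Proc. London Math. Soc. (3) 114 (2017) 684–732, arXiv:1504.05549, §5.5 p. 20–21,
  Theorem 2.1. [cite: Drappeau2017, §5.5]
-/

noncomputable section

open Finset Real Complex
open scoped ArithmeticFunction.Moebius FourierTransform

namespace Literature.NumberTheory.Sieve

namespace Drappeau2017

/-- **The coefficients `b_{𝐧,𝐫,𝐬}`** (p. 20), for the data of `ℛ₁''`, divisors `δ₁, δ₂`, a sign
`σ` and a block `[nlo, nhi)`: the sum over the (at most one) `(n₁, n₂, h)` with `𝐬 = δ₂n₁`,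
`𝐫 = |a₂|n₀δ₁n₂`, `𝐧 = nVar σ a₁ a₂ q₀ h n₁ n₂` (and the arithmetic side conditions) of
`β(n₀n₁) β̄(n₀n₂) e(−ξh) e(−a₁h \overline{q₀λ₁λ₂n₁}/(a₂n₀))`. [cite: Drappeau2017, §5.5 p. 20] -/
def bCoef (a₁ a₂ : ℤ) (B : Finset ℕ) (q₀ n₀ l₁ l₂ : ℕ) (β : ℕ → ℂ) (ξ : ℝ) (H : ℕ) (σ : ℤ)
    (nlo nhi δ₁ δ₂ : ℕ) (n r s : ℕ) : ℂ :=
  ∑ n₁ ∈ B, ∑ n₂ ∈ B, ∑ h ∈ (Finset.Icc (-(H : ℤ)) H).filter (fun h : ℤ => h ≠ 0),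
      if (δ₂ * n₁ = s ∧ a₂.natAbs * n₀ * δ₁ * n₂ = r ∧ nVar σ a₁ a₂ q₀ h n₁ n₂ = (n : ℤ) ∧
          (Nat.Coprime n₁ n₂ ∧ n₁ ≡ n₂ [MOD q₀] ∧ (n₀ * n₁).Coprime q₀ ∧ (n₀ * n₂).Coprime q₀ ∧
            ((nlo : ℕ) : ℤ) ≤ nVar σ a₁ a₂ q₀ h n₁ n₂ ∧ nVar σ a₁ a₂ q₀ h n₁ n₂ < ((nhi : ℕ) : ℤ))) then
        (β (n₀ * n₁) * starRingEnd ℂ (β (n₀ * n₂)) *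
              ((𝐞 (-(ξ * h)) : ℂ) *
                (𝐞 (-((h : ℝ) * a₁ *
                    ((((((q₀ : ℤ) * l₁ * l₂ * n₁ : ℤ) : ZMod (a₂.natAbs * n₀))⁻¹).val : ℕ) : ℝ) /
                      ((a₂ : ℝ) * n₀))) : ℂ)))
      else 0

/-- `1_P · (∑∑∑ 1_Q V) · w = ∑∑∑ 1_{P ∧ Q} V w`. [folklore] -/
theorem ite_sum3_mul (P : Prop) [Decidable P] (B : Finset ℕ) (Hs : Finset ℤ)
    (Q : ℕ → ℕ → ℤ → Prop) [∀ n₁ n₂ h, Decidable (Q n₁ n₂ h)] (V : ℕ → ℕ → ℤ → ℂ) (w : ℂ) :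
    (if P then (∑ n₁ ∈ B, ∑ n₂ ∈ B, ∑ h ∈ Hs, if Q n₁ n₂ h then V n₁ n₂ h else 0) * w else 0) =
      ∑ n₁ ∈ B, ∑ n₂ ∈ B, ∑ h ∈ Hs, if (P ∧ Q n₁ n₂ h) then V n₁ n₂ h * w else 0 := by
  by_cases hP : P
  · simp only [hP, true_and, if_true]
    rw [Finset.sum_mul]
    refine Finset.sum_congr rfl fun n₁ _ => ?_
    rw [Finset.sum_mul]
    refine Finset.sum_congr rfl fun n₂ _ => ?_
    rw [Finset.sum_mul]
    refine Finset.sum_congr rfl fun h _ => ?_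
    split_ifs <;> simp
  · simp only [hP, false_and, if_false]
    simp

/-- Collapsing `∑_{n,r,s} 1_{s₀ = s, r₀ = r, z = n, …}`: at most the term `(z, r₀, s₀)` survives.
[folklore] -/
theorem sum3_collapse (In Ir Is : Finset ℕ) (z : ℤ) (r₀ s₀ : ℕ) (P : ℕ → ℕ → ℕ → Prop)
    [∀ n r s, Decidable (P n r s)] (R : Prop) [Decidable R] (X : ℕ → ℕ → ℕ → ℂ) :
    ∑ n ∈ In, ∑ r ∈ Ir, ∑ s ∈ Is, (if (P n r s ∧ (s₀ = s ∧ r₀ = r ∧ z = (n : ℤ) ∧ R)) then X n r s else 0) =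
      if (0 ≤ z ∧ z.toNat ∈ In ∧ r₀ ∈ Ir ∧ s₀ ∈ Is ∧ P z.toNat r₀ s₀ ∧ R) then X z.toNat r₀ s₀
      else 0 := by
  -- the `s`-sum
  have hs : ∀ n r, ∑ s ∈ Is, (if (P n r s ∧ (s₀ = s ∧ r₀ = r ∧ z = (n : ℤ) ∧ R)) then X n r s else 0) =
      if (s₀ ∈ Is ∧ P n r s₀ ∧ r₀ = r ∧ z = (n : ℤ) ∧ R) then X n r s₀ else 0 := by
    intro n r
    by_cases hmem : s₀ ∈ Is
    · rw [Finset.sum_eq_single_of_mem s₀ hmem]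
      · by_cases h' : (P n r s₀ ∧ r₀ = r ∧ z = (n : ℤ) ∧ R)
        · rw [if_pos ⟨h'.1, rfl, h'.2⟩, if_pos ⟨hmem, h'⟩]
        · rw [if_neg (fun h'' => h' ⟨h''.1, h''.2.2⟩), if_neg (fun h'' => h' h''.2)]
      · intro s _ hne
        rw [if_neg]
        exact fun h'' => hne h''.2.1.symm
    · rw [if_neg (fun h'' => hmem h''.1)]
      refine Finset.sum_eq_zero fun s hs' => ?_
      rw [if_neg]
      rintro ⟨_, rfl, _⟩
      exact hmem hs'
  simp_rw [hs]
  -- the `r`-sum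
  have hr : ∀ n, ∑ r ∈ Ir, (if (s₀ ∈ Is ∧ P n r s₀ ∧ r₀ = r ∧ z = (n : ℤ) ∧ R) then X n r s₀ else 0) =
      if (r₀ ∈ Ir ∧ s₀ ∈ Is ∧ P n r₀ s₀ ∧ z = (n : ℤ) ∧ R) then X n r₀ s₀ else 0 := by
    intro n
    by_cases hmem : r₀ ∈ Ir
    · rw [Finset.sum_eq_single_of_mem r₀ hmem]
      · by_cases h' : (s₀ ∈ Is ∧ P n r₀ s₀ ∧ z = (n : ℤ) ∧ R)
        · rw [if_pos ⟨h'.1, h'.2.1, rfl, h'.2.2⟩, if_pos ⟨hmem, h'⟩]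
        · rw [if_neg (fun h'' => h' ⟨h''.1, h''.2.1, h''.2.2.2⟩), if_neg (fun h'' => h' h''.2)]
      · intro r _ hne
        rw [if_neg]
        exact fun h'' => hne h''.2.2.1.symm
    · rw [if_neg (fun h'' => hmem h''.1)]
      refine Finset.sum_eq_zero fun r hr' => ?_
      rw [if_neg]
      rintro ⟨_, _, rfl, _⟩
      exact hmem hr'
  simp_rw [hr]
  -- the `n`-sum
  by_cases hz : 0 ≤ z
  · have hzn : ((z.toNat : ℕ) : ℤ) = z := Int.toNat_of_nonneg hz
    by_cases hmem : z.toNat ∈ In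
    · rw [Finset.sum_eq_single_of_mem z.toNat hmem]
      · by_cases h' : (r₀ ∈ Ir ∧ s₀ ∈ Is ∧ P z.toNat r₀ s₀ ∧ R)
        · rw [if_pos ⟨h'.1, h'.2.1, h'.2.2.1, hzn.symm, h'.2.2.2⟩,
            if_pos ⟨hz, hmem, h'.1, h'.2.1, h'.2.2.1, h'.2.2.2⟩]
        · rw [if_neg (fun h'' => h' ⟨h''.1, h''.2.1, h''.2.2.1, h''.2.2.2.2⟩),
            if_neg (fun h'' => h' ⟨h''.2.2.1, h''.2.2.2.1, h''.2.2.2.2.1, h''.2.2.2.2.2⟩)]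
      · intro n _ hne
        rw [if_neg]
        intro h''
        apply hne
        have := h''.2.2.2.1
        omega
    · rw [if_neg (fun h'' => hmem h''.2.1)]
      refine Finset.sum_eq_zero fun n hn' => ?_
      rw [if_neg]
      intro h''
      apply hmem
      have := h''.2.2.2.1
      have e : z.toNat = n := by omega
      rw [e]; exact hn'
  · rw [if_neg (fun h'' => hz h''.1)]
    refine Finset.sum_eq_zero fun n _ => ?_
    rw [if_neg]
    intro h''
    have := h''.2.2.2.1
    omega

/-- **The left-hand side of Theorem 2.1 with coefficients `bCoef`, collapsed**: for any finite
index sets and any weight `g`,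
`∑_{𝐜,𝐝,𝐧,𝐫,𝐬} 1_{𝐜≡c₀, 𝐝≡d₀ (m), (m𝐫𝐝,𝐬𝐜)=1} b_{𝐧,𝐫,𝐬} g e(𝐧\overline{𝐫𝐝}/(𝐬𝐜))`
`= ∑_{𝐜,𝐝} ∑_{n₁,n₂,h} 1_{…} β(n₀n₁)β̄(n₀n₂)e(−ξh)e(⋯) g(𝐜,𝐝,𝐧,𝐫,𝐬) e(𝐧\overline{𝐫𝐝}/(𝐬𝐜))`
with `(𝐧,𝐫,𝐬) = (nVar, |a₂|n₀δ₁n₂, δ₂n₁)`. [cite: Drappeau2017, §5.5 p. 20] -/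
theorem cruxLHS_bCoef_eq (a₁ a₂ : ℤ) (B : Finset ℕ) (q₀ n₀ l₁ l₂ : ℕ) (β : ℕ → ℂ) (ξ : ℝ)
    (H : ℕ) (σ : ℤ) (nlo nhi δ₁ δ₂ : ℕ) (Ic Id In Ir Is : Finset ℕ) (m c₀ d₀ : ℕ)
    (g : ℝ → ℝ → ℝ → ℝ → ℝ → ℂ) :
    ∑ c ∈ Ic, ∑ d ∈ Id, ∑ n ∈ In, ∑ r ∈ Ir, ∑ s ∈ Is,
        (if (c ≡ c₀ [MOD m] ∧ d ≡ d₀ [MOD m] ∧ Nat.Coprime (m * r * d) (s * c)) then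
          bCoef a₁ a₂ B q₀ n₀ l₁ l₂ β ξ H σ nlo nhi δ₁ δ₂ n r s * g c d n r s *
            (𝐞 ((n : ℝ) * ((((r * d : ℕ) : ZMod (s * c))⁻¹).val : ℝ) / ((s : ℝ) * c)) : ℂ)
        else 0) =
      ∑ c ∈ Ic, ∑ d ∈ Id, ∑ n₁ ∈ B, ∑ n₂ ∈ B,
        ∑ h ∈ (Finset.Icc (-(H : ℤ)) H).filter (fun h : ℤ => h ≠ 0),
          if (0 ≤ nVar σ a₁ a₂ q₀ h n₁ n₂ ∧ (nVar σ a₁ a₂ q₀ h n₁ n₂).toNat ∈ In ∧ (a₂.natAbs * n₀ * δ₁ * n₂) ∈ Ir ∧ (δ₂ * n₁) ∈ Is ∧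
          (c ≡ c₀ [MOD m] ∧ d ≡ d₀ [MOD m] ∧ Nat.Coprime (m * (a₂.natAbs * n₀ * δ₁ * n₂) * d) ((δ₂ * n₁) * c)) ∧
          (Nat.Coprime n₁ n₂ ∧ n₁ ≡ n₂ [MOD q₀] ∧ (n₀ * n₁).Coprime q₀ ∧ (n₀ * n₂).Coprime q₀ ∧
            ((nlo : ℕ) : ℤ) ≤ nVar σ a₁ a₂ q₀ h n₁ n₂ ∧ nVar σ a₁ a₂ q₀ h n₁ n₂ < ((nhi : ℕ) : ℤ))) then
            (β (n₀ * n₁) * starRingEnd ℂ (β (n₀ * n₂)) *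
              ((𝐞 (-(ξ * h)) : ℂ) *
                (𝐞 (-((h : ℝ) * a₁ *
                    ((((((q₀ : ℤ) * l₁ * l₂ * n₁ : ℤ) : ZMod (a₂.natAbs * n₀))⁻¹).val : ℕ) : ℝ) /
                      ((a₂ : ℝ) * n₀))) : ℂ))) *
            (g c d (nVar σ a₁ a₂ q₀ h n₁ n₂).toNat ((a₂.natAbs * n₀ * δ₁ * n₂ : ℕ) : ℝ) ((δ₂ * n₁ : ℕ) : ℝ) *
              (𝐞 (((nVar σ a₁ a₂ q₀ h n₁ n₂).toNat : ℝ) * (((((a₂.natAbs * n₀ * δ₁ * n₂) * d : ℕ) : ZMod ((δ₂ * n₁) * c))⁻¹).val : ℝ) /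
                (((δ₂ * n₁ : ℕ) : ℝ) * c)) : ℂ))
          else 0 := by
  refine Finset.sum_congr rfl fun c _ => Finset.sum_congr rfl fun d _ => ?_
  have step1 : ∀ n r s : ℕ,
      (if (c ≡ c₀ [MOD m] ∧ d ≡ d₀ [MOD m] ∧ Nat.Coprime (m * r * d) (s * c)) then
          bCoef a₁ a₂ B q₀ n₀ l₁ l₂ β ξ H σ nlo nhi δ₁ δ₂ n r s * g c d n r s *
            (𝐞 ((n : ℝ) * ((((r * d : ℕ) : ZMod (s * c))⁻¹).val : ℝ) / ((s : ℝ) * c)) : ℂ)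
        else 0) =
        ∑ n₁ ∈ B, ∑ n₂ ∈ B, ∑ h ∈ (Finset.Icc (-(H : ℤ)) H).filter (fun h : ℤ => h ≠ 0),
          if ((c ≡ c₀ [MOD m] ∧ d ≡ d₀ [MOD m] ∧ Nat.Coprime (m * r * d) (s * c)) ∧
              (δ₂ * n₁ = s ∧ a₂.natAbs * n₀ * δ₁ * n₂ = r ∧ nVar σ a₁ a₂ q₀ h n₁ n₂ = (n : ℤ) ∧
          (Nat.Coprime n₁ n₂ ∧ n₁ ≡ n₂ [MOD q₀] ∧ (n₀ * n₁).Coprime q₀ ∧ (n₀ * n₂).Coprime q₀ ∧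
            ((nlo : ℕ) : ℤ) ≤ nVar σ a₁ a₂ q₀ h n₁ n₂ ∧ nVar σ a₁ a₂ q₀ h n₁ n₂ < ((nhi : ℕ) : ℤ)))) then
            (β (n₀ * n₁) * starRingEnd ℂ (β (n₀ * n₂)) *
              ((𝐞 (-(ξ * h)) : ℂ) *
                (𝐞 (-((h : ℝ) * a₁ *
                    ((((((q₀ : ℤ) * l₁ * l₂ * n₁ : ℤ) : ZMod (a₂.natAbs * n₀))⁻¹).val : ℕ) : ℝ) /
                      ((a₂ : ℝ) * n₀))) : ℂ))) *
              (g c d n r s *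
                (𝐞 ((n : ℝ) * ((((r * d : ℕ) : ZMod (s * c))⁻¹).val : ℝ) / ((s : ℝ) * c)) : ℂ))
          else 0 := by
    intro n r s
    unfold bCoef
    rw [show ∀ (P : Prop) [Decidable P] (T w₁ w₂ : ℂ), (if P then T * w₁ * w₂ else 0) =
        (if P then T * (w₁ * w₂) else 0) from fun P _ T w₁ w₂ => by split_ifs <;> ring]
    exact ite_sum3_mul _ B _ _ _ _
  simp_rw [step1]
  simp only [Finset.sum_comm (s := Is) (t := B),
    Finset.sum_comm (s := Is) (t := (Finset.Icc (-(H : ℤ)) H).filter (fun h : ℤ => h ≠ 0)),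
    Finset.sum_comm (s := Ir) (t := B),
    Finset.sum_comm (s := Ir) (t := (Finset.Icc (-(H : ℤ)) H).filter (fun h : ℤ => h ≠ 0)),
    Finset.sum_comm (s := In) (t := B),
    Finset.sum_comm (s := In) (t := (Finset.Icc (-(H : ℤ)) H).filter (fun h : ℤ => h ≠ 0))]
  refine Finset.sum_congr rfl fun n₁ _ => Finset.sum_congr rfl fun n₂ _ =>
    Finset.sum_congr rfl fun h _ => ?_
  rw [sum3_collapse In Ir Is (nVar σ a₁ a₂ q₀ h n₁ n₂) (a₂.natAbs * n₀ * δ₁ * n₂) (δ₂ * n₁)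
    (fun n r s => (c ≡ c₀ [MOD m] ∧ d ≡ d₀ [MOD m] ∧ Nat.Coprime (m * r * d) (s * c)))
    (Nat.Coprime n₁ n₂ ∧ n₁ ≡ n₂ [MOD q₀] ∧ (n₀ * n₁).Coprime q₀ ∧ (n₀ * n₂).Coprime q₀ ∧
            ((nlo : ℕ) : ℤ) ≤ nVar σ a₁ a₂ q₀ h n₁ n₂ ∧ nVar σ a₁ a₂ q₀ h n₁ n₂ < ((nhi : ℕ) : ℤ))]

end Drappeau2017

end Literature.NumberTheory.Sieve

end
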